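import Literature.MathematicalPhysics.QuantumFieldTheory.Balaban1983to89.B9B8KnitLetterHprimeLap
import Literature.MathematicalPhysics.QuantumFieldTheory.Balaban1983to89.B9B8KnitLetterCinvFromM56

/-!
# `Balaban1983to89.B9B8KnitLetterHprimeFromM56` — [B8] (1.92) FOR `H′ = G′²Q′*(Q′G′²Q′*)⁻¹` AT THE KNIT LETTER `parKnitY` FROM THEOREM-3.1-TYPE SITE
# MAJORANTS AND M5.6's PER-CUBE DATA, END TO END: the three lines `|H′X| ≦ B₀′|X|` (E6), `(Lʲη)|∇_{U₀}H′X| ≦ B₀′|X|` (E7), `(Lʲη)²|Δ_{U₀}H′X| ≦ B₂′|X|` (E8) of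
# `B8Thm2TorusLetters.LettersAt` with the displayed (3.48)-shape majorant `hC` of junction files 18–19 DISCHARGED by junction file 20's
# `hasMajorant_conj_XinvY_parKnitY_of_site` ([B9] Thm 3.9 ⇒ Thm 3.2 at `parS := parKnitY`) — junction J-B file 22, the (E6)∕(E7)∕(E8) companions of file 20's
# `knit_E15_constLev_of_site`

statement-level skeleton of published theorems with citation tags; proofs where landed; nothing here is a claim about the
Yang–Mills mass gap

THE PRINT.  [B8] = [Balaban1985RegularSpaces] (1.91)–(1.92) p. 91: *«H′ = G′²Q′*(Q′G′²Q′*)⁻¹ … |H′X|, (Lʲη)|∇_{U₀}H′X|, (Lʲη)²|Δ_{U₀}H′X| ≦ B₀|X| on Ωⱼ»*, with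
p. 77 *«Ω_j = T_η»* (one level at a time: the (T) presentation); [B9] = [Balaban1985BackgroundPropagators] Thm 3.2 (3.48) p. 398 (the majorant of
`(Q′G′²Q′*)⁻¹`), Thm 3.1 (3.42) p. 397 (the majorants of `G′`, `∇G′`), Thm 3.9 p. 413 and (3.95)–(3.96) p. 411 (Thm 3.2 from the cube expansion), (3.49) p. 399
(words of such operators, «using again Lemma 2.1»).

WHY THIS FILE (cell context).  Junction files 18 (`knit_E6_constLev`, `knit_E7_constLev`) and 19 (`knit_E8_at_box`) prove (E6)–(E8) at the knit letter from two
DISPLAYED majorants: the (3.42)₁-shape site majorant `hGm` of `η²G′(U; parKnitY)` (junction file 15's output shape) and the (3.48)-shape block majorant `hC` of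
`s·(Q′G′²Q′*)⁻¹(U; parKnitY)`.  File 20 supplies `hC` from M5.6 (p21's `B9Thm39CinvTorusRegularFinal`) at `parS := parKnitY`; file 20 §3 composed it with (E15).
This file composes it with (E6), (E7), (E8) — so that every H′-law of `LettersAt` at print's transporters is stated with NO displayed (3.48) majorant, from
Theorem-3.1-type site majorants (of `η²G′`, of the cube letters `η²G′_□`, and for (E7) the (3.42)₂-type left entry) and M5.6's per-cube package VERBATIM.

WHAT IS PROVED (all `theorem`s, no `sorry`, no definition).  On a constant-level-`n` member (`hlev`), for `G ≤ U(N)` (`N ≥ 1`), a `G`-valued `U` with `G`-valued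
knit legs, under the hypotheses of file 20's `hasMajorant_conj_XinvY_parKnitY_of_site` and the (3.49)-word bookkeeping (`(1−α′)ρδ₀ ≦ δ_G`, (2.61) at `(ε₀, β)` with
`ρ₃ + 2βε₀ ≦ (1−α′)ρδ₀`, row sum `c₃` at `ρ₃`), with `K := N·B₀·c₁(ρδ₀,α′)·(1 − (θ₁+θ₂+θ₃)c₁(ρδ₀,α′))⁻¹`:
* ★★★ `knit_E6_constLev_of_site`: `‖(G′G′Q′*C Y)(z)‖ ≦ (Σ‖b_j‖)·((M₂Σ‖b_j‖)·A·A·K·c₁(ε₀,β)²)·c₃·(M₂M)` for `‖Y(s)‖ ≦ M`.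
* ★★★ `knit_E7_constLev_of_site`: `Lʲ·‖(∇_{U,μ}G′G′Q′*C Y)(z)‖ ≦ (Σ‖b_j‖)·((M₂Σ‖b_j‖)·A₁·A·K·c₁(ε₀,β)²)·c₃·(M₂M)`, `j ≦ n`, from the extra DISPLAYED (3.42)₂-type left
  entry `conj b(η⁻¹∇_{U,μ})·conj b(η²G′(U; parKnitY)) ≺ A₁ℓe^{−δ_Dd}` (junction file 16's output shape) at any rate `δ_D ≧ (1−α′)ρδ₀`.
* ★★★ `knit_E8_at_box_of_site`: `(Lʲη′)²‖(Δ^{η′}_{Ũ} H′Y~)(z)‖ ≦ (Σ‖b‖)·((M₂Σ‖b‖)AKc₁)·c₃·(M₂M) + (Σ‖b‖)·((M₂Σ‖b‖)AAKc₁²)·c₃·(M₂M)` in the consumer's `covLap` on the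
  periodic lift (J-A `covLap_liftY`), `j ≦ n`.
Each is `hasMajorant_conj_XinvY_parKnitY_of_site` + a rate weakening of the displayed site majorants to the common rate `(1−α′)ρδ₀` + the file-18∕19 theorem.
* ★★ `knit_E7_lift`, `knit_E8_lift`: (E7)∕(E8) from the displayed majorants of files 18∕19, read in the consumer's `covDerivFwd` ∕ `covLap` on the periodic lift at
  EVERY point of `ℤ^{d+1}` (J-A `covDerivFwd_liftY` ∕ `covLap_liftY`) — the left sides of `KnitEstimates.hp_grad` ∕ `hp_lap` of the M5.9 assembly.

MODEL ∕ DECLARED READINGS.  As in junction files 17–20 (M1–M4 of file 17: `𝔸 = M_N(ℂ)`, `G ≤ U(N)`, lattice units with `η² ↔ etaS²`, `s·η²η² = 1`; the cube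
letters `Oc k` and their data are M5.6's, AT `par := parKnitY` — the junction does not transfer cube letters between transporter conventions).
HONEST SCOPE.  Exact algebra + the cited inequalities as typed upstream; no new estimate is proved here beyond composition; NOT summit progress.  Consumers:
the M5.9 assembler of `LettersAt` at the knit letter (RECORD-JB-g95.md).  A NEW file importing junction files 19 and 20; nothing landed is modified;
junction J-B file 22, seat p33 gen 95, 2026-08-28.
Net new unproved facts: 0.
-/

noncomputable section

namespace Literature.MathematicalPhysics.QuantumFieldTheory.Balaban1983to89.B9B8KnitLetterHprimeFromM56

open Node00 B6KLevelCensusIndexV1 B6Geom246MultiLevelBox B9BackgroundsKLevelV1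
open B6RandomWalk (HasMajorant Triangle254 Ineq261 Ineq263 hasMajorant_mono c1_nonneg)
open B9Thm34Ext (toB6)
open B9GeoNormsKLevelV1 (geo9K geo9K_len_kGeo)
open B9Eq352DivFormLetters (conj)
open B9Eq352GradLetters (diffLetter)
open B9Thm37CubeCoverCommutators (cutMulY)
open B9Ineq347 (ScaleTransfer)
open B6GlobalChartV1 (boxEquiv)
open B8Eq138LandauZd (covLap)
open B8Ineq132 (covDerivFwd)
open B10Eq27TorusAxialLog (transl)
open B9B8CarrierDictionary (liftCfg liftFun covLap_liftY covDerivFwd_liftY)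
open B9B8AveragingJunction (parKnitY)
open B9B8KnitLetterHprimeBounds (knit_E6_constLev knit_E7_constLev knit_E7_constLev')
open B9B8KnitLetterHprimeLap (knit_E8_constLev knit_E8_at_box)
open B9B8KnitLetterCinvFromM56 (hasMajorant_conj_XinvY_parKnitY_of_site)
open scoped Matrix Matrix.Norms.L2Operator

variable {d ℓ : ℕ} {hd : 1 ≤ d + 1} {hL : Odd (ℓ + 1) ∧ 1 < ℓ + 1} {b₀ b₁ : ℝ}
variable (i : KIdx d ℓ hd hL b₀ b₁)

section Knit

variable {N : ℕ} {G : Subgroup (Matrix (Fin N) (Fin N) ℂ)ˣ}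
variable {ι : Type} [Fintype ι] [DecidableEq ι] (b : Module.Basis ι ℝ (Matrix (Fin N) (Fin N) ℂ))
variable [Fintype (geo9K i).Site] [DecidableEq (geo9K i).Site] {Rr : ℝ} {Hp : Prop} (ιB : BlkY i → IBondY i)

omit [Fintype ι] [DecidableEq ι] [DecidableEq (geo9K i).Site] in
/-- rate weakening of a (3.42)₁-shape site majorant `A·ℓ²·e^{−δ_Gd}` to a smaller rate `δ ≦ δ_G`. [cite: Balaban1985BackgroundPropagators, Thm 3.1 (3.42) p.397, (3.49) p.399, bookkeeping] -/
theorem hasMajorant_sq_rate_mono {X : Type} (loc : X → IBondY i) (T : Module.End ℝ (X → ℝ)) {A δG δ : ℝ} (hA : 0 ≤ A)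
    (hdnn : ∀ a a' : (geo9K i).Site, 0 ≤ (geo9K i).dist a a') (hrate : δ ≤ δG)
    (h : HasMajorant (g := toB6 (geo9K i) Rr Hp) loc T (fun a a' => A * (geo9K i).len a ^ 2 * Real.exp (-(δG * (geo9K i).dist a a')))) :
    HasMajorant (g := toB6 (geo9K i) Rr Hp) loc T (fun a a' => A * (geo9K i).len a ^ 2 * Real.exp (-(δ * (geo9K i).dist a a'))) :=
  hasMajorant_mono (g := toB6 (geo9K i) Rr Hp) _ h fun a a' =>
    mul_le_mul_of_nonneg_left (Real.exp_le_exp.mpr (by nlinarith [hdnn a a', mul_le_mul_of_nonneg_right hrate (hdnn a a')]))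
      (mul_nonneg hA (sq_nonneg _))

omit [Fintype ι] [DecidableEq ι] [DecidableEq (geo9K i).Site] in
/-- rate weakening of a (3.42)₂-shape site majorant `A₁·ℓ·e^{−δ_Dd}` to a smaller rate `δ ≦ δ_D`. [cite: Balaban1985BackgroundPropagators, Thm 3.1 (3.42) p.397, (3.49) p.399, bookkeeping] -/
theorem hasMajorant_len_rate_mono {X : Type} (loc : X → IBondY i) (T : Module.End ℝ (X → ℝ)) {A₁ δD δ : ℝ} (hA₁ : 0 ≤ A₁)
    (hdnn : ∀ a a' : (geo9K i).Site, 0 ≤ (geo9K i).dist a a') (hrate : δ ≤ δD)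
    (h : HasMajorant (g := toB6 (geo9K i) Rr Hp) loc T (fun a a' => A₁ * (geo9K i).len a * Real.exp (-(δD * (geo9K i).dist a a')))) :
    HasMajorant (g := toB6 (geo9K i) Rr Hp) loc T (fun a a' => A₁ * (geo9K i).len a * Real.exp (-(δ * (geo9K i).dist a a'))) :=
  hasMajorant_mono (g := toB6 (geo9K i) Rr Hp) _ h fun a a' =>
    mul_le_mul_of_nonneg_left (Real.exp_le_exp.mpr (by nlinarith [hdnn a a', mul_le_mul_of_nonneg_right hrate (hdnn a a')]))
      (mul_nonneg hA₁ (by rw [geo9K_len_kGeo]; exact (len_pos i a).le))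

/-- ★★★ **(E6) `hp_sup` OF `B8Thm2TorusLetters.LettersAt` AT THE KNIT LETTER FROM THEOREM-3.1-TYPE DATA, END TO END** (junction file 18's `knit_E6_constLev` ∘
file 20's `hasMajorant_conj_XinvY_parKnitY_of_site`): on a constant-level-`n` member, for `G ≤ U(N)` (`N ≥ 1`), a `G`-valued `U` with `G`-valued knit legs, under the
hypotheses of `hasMajorant_conj_XinvY_parKnitY_of_site` and, for the word of (3.49): `(1−α′)ρδ₀ ≦ δ_G`, (2.61) at `(ε₀, β)` with `ρ₃ + 2βε₀ ≦ (1−α′)ρδ₀`, a row-sum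
constant `c₃` at `ρ₃`; then for every block family `Y` with `‖Y(s)‖ ≦ M`:
`‖(G′G′Q′*C Y)(z)‖ ≦ (Σ‖b_j‖)·((M₂Σ‖b_j‖)·A·A·K·c₁(ε₀,β)²)·c₃·(M₂M)`, `K = N B₀c₁(ρδ₀,α′)(1 − (θ₁+θ₂+θ₃)c₁)⁻¹` — [B8] (1.92) line 1 at print's transporters with NO
displayed (3.48) majorant left. [cite: Balaban1985RegularSpaces, (1.91)–(1.92) p.91, p.77 («Ω_j = T_η»); Balaban1985BackgroundPropagators, Thm 3.1 (3.42) p.397, Thm 3.2 (3.48) p.398, (3.49) p.399, Thm 3.9 p.413; Balaban1984PropagatorsII, (2.61) p.234] -/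
theorem knit_E6_constLev_of_site [Nonempty (Fin N)] {n : ℕ} (hlev : ∀ z : SiteY i, levY i z = n)
    (hG : G ≤ B7Prop2Explicit.unitaryUnits (Matrix (Fin N) (Fin N) ℂ))
    {U : CfgY (Matrix (Fin N) (Fin N) ℂ) i} (hU : ∀ μ x, U μ x ∈ G) (hpar : ∀ z w : SiteY i, parKnitY i U z w ∈ G)
    {κι : Type} [Fintype κι] (Oc : κι → SiteOpY (Matrix (Fin N) (Fin N) ℂ) i)
    {M₂ : ℝ} (hM₂ : 0 ≤ M₂) (hrepr : ∀ (v : Matrix (Fin N) (Fin N) ℂ) (j : ι), |b.repr v j| ≤ M₂ * ‖v‖) (d' d₂ : ℕ)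
    {A δG αG α₂ CG : ℝ} (hA : 0 ≤ A) (hCG : 0 ≤ CG) (hαGδ : 0 ≤ αG * δG) (hα₂0 : 0 ≤ α₂) (hα₂1 : α₂ ≤ 1) (hδG : 0 ≤ (1 - αG) * δG)
    (hSTG : B9Ineq347.ScaleTransfer (geo9K i) δG αG CG (fun a => (geo9K i).len a ^ 2))
    (h261G : Ineq261 d₂ (toB6 (geo9K i) Rr Hp) ((1 - αG) * δG) α₂)
    (hGm : HasMajorant (g := toB6 (geo9K i) Rr Hp) (fun p : SiteY i × ι => ιB (blkOf i.D.toDomains p.1))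
      (conj b ((etaS i ^ 2) • (GpY i (parKnitY i) U).restrictScalars ℝ)) (fun a a' => A * (geo9K i).len a ^ 2 * Real.exp (-(δG * (geo9K i).dist a a'))))
    (hGc : ∀ k, HasMajorant (g := toB6 (geo9K i) Rr Hp) (fun p : SiteY i × ι => ιB (blkOf i.D.toDomains p.1))
      (conj b ((etaS i ^ 2) • (Oc k U).restrictScalars ℝ)) (fun a a' => A * (geo9K i).len a ^ 2 * Real.exp (-(δG * (geo9K i).dist a a'))))
    {δ₀ aL aD αc αst asep ρ bb κG κD Dsep ℓ₀ ℓ₁ B₀ C Nn s α' θ₁ θ₂ θ₃ : ℝ} (hrate : aL * δ₀ ≤ (1 - α₂) * ((1 - αG) * δG))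
    (Sχ S : κι → Finset (geo9K i).Site) (χ h : κι → BlkY i → ℝ) (Cl : κι → Module.End ℝ (BlkY i → Matrix (Fin N) (Fin N) ℂ))
    (hs : (etaS i ^ 2 * etaS i ^ 2) * s = 1) (hκD : 0 ≤ κD) (hℓ₀ : 0 ≤ ℓ₀) (hℓ₁ : 0 ≤ ℓ₁) (hB₀ : 0 ≤ B₀) (hC0 : 0 ≤ C) (hN : 0 ≤ Nn)
    (hδ₀ : 0 ≤ δ₀) (hasep : 0 ≤ asep) (hρ : 0 ≤ ρ) (hρb : ρ ≤ bb) (hαc : 0 < αc * δ₀) (hα'1 : α' ≤ 1)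
    (hsplit₁ : αst + asep + ρ ≤ aL) (hsplit₂ : αst + ρ ≤ aD) (hsplit₃ : αst + αc + ρ ≤ aL)
    (hκG : κG = A ^ 2 * CG * B6.c1 d₂ ((1 - αG) * δG) α₂)
    (hθ₁ : θ₁ = Nn * (((M₂ * ∑ j, ‖b j‖) ^ 2 * κG) * B₀ * C * B6.c1 d' δ₀ (bb - ρ) * Real.exp (-(asep * δ₀ * Dsep))))
    (hθ₂ : θ₂ = Nn * (κD * Real.exp (-(2 * δ₀ * Dsep)) * B₀ * C * B6.c1 d' δ₀ (bb - ρ)))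
    (hθ₃ : θ₃ = Nn * ((ℓ₀ + ℓ₁ * (αc * δ₀)⁻¹) * ((M₂ * ∑ j, ‖b j‖) ^ 2 * κG) * B₀ * C * B6.c1 d' δ₀ (bb - ρ)))
    (htri : Triangle254 (toB6 (geo9K i) Rr Hp)) (hrefl : ∀ y : (geo9K i).Site, (geo9K i).dist y y = 0)
    (hsymm : ∀ a a' : (geo9K i).Site, (geo9K i).dist a a' = (geo9K i).dist a' a) (hdnn : ∀ a a' : (geo9K i).Site, 0 ≤ (geo9K i).dist a a')
    (hST : B9Ineq347.ScaleTransfer (geo9K i) δ₀ αst C (fun a => ((geo9K i).len a ^ 4)⁻¹)) (h261b : Ineq261 d' (toB6 (geo9K i) Rr Hp) δ₀ (bb - ρ))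
    (h261 : Ineq261 d' (toB6 (geo9K i) Rr Hp) (ρ * δ₀) α') (h263 : Ineq263 d' (toB6 (geo9K i) Rr Hp) (ρ * δ₀) α')
    (hsmall : (θ₁ + θ₂ + θ₃) * B6.c1 d' (ρ * δ₀) α' < 1)
    (hsq : ∀ t, ∑ k, h k t ^ 2 = 1) (hh : ∀ k t, |h k t| ≤ 1) (hS : ∀ k t, h k t ≠ 0 → ιB t ∈ S k)
    (hcnt : ∀ a : (geo9K i).Site, (∑ k, if a ∈ S k then (1 : ℝ) else 0) ≤ Nn)
    (hχ01 : ∀ k t, 0 ≤ χ k t ∧ χ k t ≤ 1) (hχS : ∀ k t, ιB t ∈ Sχ k → χ k t = 1)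
    (hsep : ∀ k a, a ∉ Sχ k → ∀ a'' ∈ S k, Dsep ≤ (geo9K i).dist a a'')
    (hLip : ∀ k (t t' : BlkY i), |h k t' - h k t| ≤ ℓ₀ + ℓ₁ * (geo9K i).dist (ιB t) (ιB t'))
    (hloc : ∀ k, (cutMulY (𝔸 := Matrix (Fin N) (Fin N) ℂ) (h k)).restrictScalars ℝ *
      ((cutMulY (𝔸 := Matrix (Fin N) (Fin N) ℂ) (χ k)).restrictScalars ℝ * (XY i (parKnitY i) (Oc k) U).restrictScalars ℝ) * Cl k *
        (cutMulY (𝔸 := Matrix (Fin N) (Fin N) ℂ) (h k)).restrictScalars ℝ =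
      (cutMulY (𝔸 := Matrix (Fin N) (Fin N) ℂ) (h k)).restrictScalars ℝ * (cutMulY (𝔸 := Matrix (Fin N) (Fin N) ℂ) (h k)).restrictScalars ℝ)
    (hC : ∀ k, HasMajorant (g := toB6 (geo9K i) Rr Hp) (fun p : BlkY i × ι => ιB p.1) (conj b (s • Cl k))
      (fun a a' => if a ∈ S k then B₀ * ((geo9K i).len a ^ 4)⁻¹ * Real.exp (-(bb * δ₀ * (geo9K i).dist a a')) else 0))
    (hD : ∀ k, HasMajorant (g := toB6 (geo9K i) Rr Hp) (fun p : BlkY i × ι => ιB p.1)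
      (conj b ((etaS i ^ 2 * etaS i ^ 2) • ((XY i (parKnitY i) (GpY i (parKnitY i)) U).restrictScalars ℝ - (XY i (parKnitY i) (Oc k) U).restrictScalars ℝ)))
      (fun a a'' => κD * Real.exp (-(2 * δ₀ * Dsep)) * (geo9K i).len a ^ 4 * Real.exp (-(aD * δ₀ * (geo9K i).dist a a''))))
    -- the word of (3.49): rates, (2.61) at `(ε₀, β)`, row sum at `ρ₃`
    (hrateG : (1 - α') * (ρ * δ₀) ≤ δG) (d₃ : ℕ) {ε₀ βx ρ₃ c₃ : ℝ} (hρ₃ : 0 ≤ ρ₃) (hβ : 0 ≤ βx) (hε₀ : 0 ≤ ε₀)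
    (hr₃ : ρ₃ + 2 * (βx * ε₀) ≤ (1 - α') * (ρ * δ₀)) (h261₃ : Ineq261 d₃ (toB6 (geo9K i) Rr Hp) ε₀ βx)
    (hrow : ∀ a : (geo9K i).Site, ∑ a' : (geo9K i).Site, Real.exp (-(ρ₃ * (geo9K i).dist a a')) ≤ c₃)
    (Y : BlkY i → Matrix (Fin N) (Fin N) ℂ) {M : ℝ} (hY : ∀ s, ‖Y s‖ ≤ M) (z : SiteY i) :
    ‖GpY i (parKnitY i) U (GpY i (parKnitY i) U (QpsY i (parKnitY i) U (XinvY i (parKnitY i) (GpY i (parKnitY i)) U Y))) z‖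
      ≤ (∑ j, ‖b j‖) * (((M₂ * ∑ j, ‖b j‖) * A * A
            * (Nn * B₀ * B6.c1 d' (ρ * δ₀) α' * (1 - (θ₁ + θ₂ + θ₃) * B6.c1 d' (ρ * δ₀) α')⁻¹) * B6.c1 d₃ ε₀ βx ^ 2) * c₃ * (M₂ * M)) := by
  have hCm := hasMajorant_conj_XinvY_parKnitY_of_site i b ιB hG hU hpar Oc hM₂ hrepr d' d₂ hA hCG hαGδ hα₂0 hα₂1 hδG hSTG h261G hGm hGc hrate Sχ S χ h Cl hs
    hκD hℓ₀ hℓ₁ hB₀ hC0 hN hδ₀ hasep hρ hρb hαc hα'1 hsplit₁ hsplit₂ hsplit₃ hκG hθ₁ hθ₂ hθ₃ htri hrefl hsymm hdnn hST h261b h261 h263 hsmall hsq hh hS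
    hcnt hχ01 hχS hsep hLip hloc hC hD
  have hK : 0 ≤ Nn * B₀ * B6.c1 d' (ρ * δ₀) α' * (1 - (θ₁ + θ₂ + θ₃) * B6.c1 d' (ρ * δ₀) α')⁻¹ :=
    mul_nonneg (mul_nonneg (mul_nonneg hN hB₀) (c1_nonneg _ _ _)) (inv_nonneg.2 (by linarith))
  exact knit_E6_constLev i b ιB hlev hG hpar hM₂ hrepr d₃ hA hK hρ₃ hβ hε₀ hr₃ hs hdnn htri h261₃
    (hasMajorant_sq_rate_mono i _ _ hA hdnn hrateG hGm) hCm hrow Y hY z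

/-- ★★★ **(E7) `hp_grad` OF `B8Thm2TorusLetters.LettersAt` AT THE KNIT LETTER FROM THEOREM-3.1-TYPE DATA, END TO END** (junction file 18's `knit_E7_constLev` ∘
file 20): as `knit_E6_constLev_of_site`, plus the chart identity `c_f = L^k` and the DISPLAYED (3.42)₂-type left entry
`conj b(η⁻¹∇_{U,μ})·conj b(η²G′(U; parKnitY)) ≺ A₁·ℓ·e^{−δ_Dd}` (junction file 16's output shape) at any rate `δ_D ≧ (1−α′)ρδ₀`; then for `j ≦ n` and `‖Y(s)‖ ≦ M`:
`Lʲ·‖(∇_{U,μ}H′Y)(z)‖ ≦ (Σ‖b_j‖)·((M₂Σ‖b_j‖)·A₁·A·K·c₁(ε₀,β)²)·c₃·(M₂M)` — [B8] (1.92) line 2 at print's transporters with NO displayed (3.48) majorant left.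
[cite: Balaban1985RegularSpaces, (1.92) p.91, p.77; Balaban1985BackgroundPropagators, Thm 3.1 (3.42) p.397, (3.3) p.390, Thm 3.2 (3.48) p.398, (3.49) p.399, Thm 3.9 p.413; Balaban1984PropagatorsII, (2.61) p.234] -/
theorem knit_E7_constLev_of_site [Nonempty (Fin N)] {n : ℕ} (hlev : ∀ z : SiteY i, levY i z = n) (hcf : i.cf = (((ℓ + 1 : ℕ) : ℝ)) ^ i.k)
    (hG : G ≤ B7Prop2Explicit.unitaryUnits (Matrix (Fin N) (Fin N) ℂ))
    {U : CfgY (Matrix (Fin N) (Fin N) ℂ) i} (hU : ∀ μ x, U μ x ∈ G) (hpar : ∀ z w : SiteY i, parKnitY i U z w ∈ G)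
    {κι : Type} [Fintype κι] (Oc : κι → SiteOpY (Matrix (Fin N) (Fin N) ℂ) i)
    {M₂ : ℝ} (hM₂ : 0 ≤ M₂) (hrepr : ∀ (v : Matrix (Fin N) (Fin N) ℂ) (j : ι), |b.repr v j| ≤ M₂ * ‖v‖) (d' d₂ : ℕ)
    {A δG αG α₂ CG : ℝ} (hA : 0 ≤ A) (hCG : 0 ≤ CG) (hαGδ : 0 ≤ αG * δG) (hα₂0 : 0 ≤ α₂) (hα₂1 : α₂ ≤ 1) (hδG : 0 ≤ (1 - αG) * δG)
    (hSTG : B9Ineq347.ScaleTransfer (geo9K i) δG αG CG (fun a => (geo9K i).len a ^ 2))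
    (h261G : Ineq261 d₂ (toB6 (geo9K i) Rr Hp) ((1 - αG) * δG) α₂)
    (hGm : HasMajorant (g := toB6 (geo9K i) Rr Hp) (fun p : SiteY i × ι => ιB (blkOf i.D.toDomains p.1))
      (conj b ((etaS i ^ 2) • (GpY i (parKnitY i) U).restrictScalars ℝ)) (fun a a' => A * (geo9K i).len a ^ 2 * Real.exp (-(δG * (geo9K i).dist a a'))))
    (hGc : ∀ k, HasMajorant (g := toB6 (geo9K i) Rr Hp) (fun p : SiteY i × ι => ιB (blkOf i.D.toDomains p.1))
      (conj b ((etaS i ^ 2) • (Oc k U).restrictScalars ℝ)) (fun a a' => A * (geo9K i).len a ^ 2 * Real.exp (-(δG * (geo9K i).dist a a'))))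
    {δ₀ aL aD αc αst asep ρ bb κG κD Dsep ℓ₀ ℓ₁ B₀ C Nn s α' θ₁ θ₂ θ₃ : ℝ} (hrate : aL * δ₀ ≤ (1 - α₂) * ((1 - αG) * δG))
    (Sχ S : κι → Finset (geo9K i).Site) (χ h : κι → BlkY i → ℝ) (Cl : κι → Module.End ℝ (BlkY i → Matrix (Fin N) (Fin N) ℂ))
    (hs : (etaS i ^ 2 * etaS i ^ 2) * s = 1) (hκD : 0 ≤ κD) (hℓ₀ : 0 ≤ ℓ₀) (hℓ₁ : 0 ≤ ℓ₁) (hB₀ : 0 ≤ B₀) (hC0 : 0 ≤ C) (hN : 0 ≤ Nn)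
    (hδ₀ : 0 ≤ δ₀) (hasep : 0 ≤ asep) (hρ : 0 ≤ ρ) (hρb : ρ ≤ bb) (hαc : 0 < αc * δ₀) (hα'1 : α' ≤ 1)
    (hsplit₁ : αst + asep + ρ ≤ aL) (hsplit₂ : αst + ρ ≤ aD) (hsplit₃ : αst + αc + ρ ≤ aL)
    (hκG : κG = A ^ 2 * CG * B6.c1 d₂ ((1 - αG) * δG) α₂)
    (hθ₁ : θ₁ = Nn * (((M₂ * ∑ j, ‖b j‖) ^ 2 * κG) * B₀ * C * B6.c1 d' δ₀ (bb - ρ) * Real.exp (-(asep * δ₀ * Dsep))))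
    (hθ₂ : θ₂ = Nn * (κD * Real.exp (-(2 * δ₀ * Dsep)) * B₀ * C * B6.c1 d' δ₀ (bb - ρ)))
    (hθ₃ : θ₃ = Nn * ((ℓ₀ + ℓ₁ * (αc * δ₀)⁻¹) * ((M₂ * ∑ j, ‖b j‖) ^ 2 * κG) * B₀ * C * B6.c1 d' δ₀ (bb - ρ)))
    (htri : Triangle254 (toB6 (geo9K i) Rr Hp)) (hrefl : ∀ y : (geo9K i).Site, (geo9K i).dist y y = 0)
    (hsymm : ∀ a a' : (geo9K i).Site, (geo9K i).dist a a' = (geo9K i).dist a' a) (hdnn : ∀ a a' : (geo9K i).Site, 0 ≤ (geo9K i).dist a a')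
    (hST : B9Ineq347.ScaleTransfer (geo9K i) δ₀ αst C (fun a => ((geo9K i).len a ^ 4)⁻¹)) (h261b : Ineq261 d' (toB6 (geo9K i) Rr Hp) δ₀ (bb - ρ))
    (h261 : Ineq261 d' (toB6 (geo9K i) Rr Hp) (ρ * δ₀) α') (h263 : Ineq263 d' (toB6 (geo9K i) Rr Hp) (ρ * δ₀) α')
    (hsmall : (θ₁ + θ₂ + θ₃) * B6.c1 d' (ρ * δ₀) α' < 1)
    (hsq : ∀ t, ∑ k, h k t ^ 2 = 1) (hh : ∀ k t, |h k t| ≤ 1) (hS : ∀ k t, h k t ≠ 0 → ιB t ∈ S k)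
    (hcnt : ∀ a : (geo9K i).Site, (∑ k, if a ∈ S k then (1 : ℝ) else 0) ≤ Nn)
    (hχ01 : ∀ k t, 0 ≤ χ k t ∧ χ k t ≤ 1) (hχS : ∀ k t, ιB t ∈ Sχ k → χ k t = 1)
    (hsep : ∀ k a, a ∉ Sχ k → ∀ a'' ∈ S k, Dsep ≤ (geo9K i).dist a a'')
    (hLip : ∀ k (t t' : BlkY i), |h k t' - h k t| ≤ ℓ₀ + ℓ₁ * (geo9K i).dist (ιB t) (ιB t'))
    (hloc : ∀ k, (cutMulY (𝔸 := Matrix (Fin N) (Fin N) ℂ) (h k)).restrictScalars ℝ *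
      ((cutMulY (𝔸 := Matrix (Fin N) (Fin N) ℂ) (χ k)).restrictScalars ℝ * (XY i (parKnitY i) (Oc k) U).restrictScalars ℝ) * Cl k *
        (cutMulY (𝔸 := Matrix (Fin N) (Fin N) ℂ) (h k)).restrictScalars ℝ =
      (cutMulY (𝔸 := Matrix (Fin N) (Fin N) ℂ) (h k)).restrictScalars ℝ * (cutMulY (𝔸 := Matrix (Fin N) (Fin N) ℂ) (h k)).restrictScalars ℝ)
    (hC : ∀ k, HasMajorant (g := toB6 (geo9K i) Rr Hp) (fun p : BlkY i × ι => ιB p.1) (conj b (s • Cl k))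
      (fun a a' => if a ∈ S k then B₀ * ((geo9K i).len a ^ 4)⁻¹ * Real.exp (-(bb * δ₀ * (geo9K i).dist a a')) else 0))
    (hD : ∀ k, HasMajorant (g := toB6 (geo9K i) Rr Hp) (fun p : BlkY i × ι => ιB p.1)
      (conj b ((etaS i ^ 2 * etaS i ^ 2) • ((XY i (parKnitY i) (GpY i (parKnitY i)) U).restrictScalars ℝ - (XY i (parKnitY i) (Oc k) U).restrictScalars ℝ)))
      (fun a a'' => κD * Real.exp (-(2 * δ₀ * Dsep)) * (geo9K i).len a ^ 4 * Real.exp (-(aD * δ₀ * (geo9K i).dist a a''))))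
    -- the (3.42)₂-type left entry of (E7) and the word of (3.49)
    (μ : Fin (d + 1)) {A₁ δD : ℝ} (hA₁ : 0 ≤ A₁) (hrateD : (1 - α') * (ρ * δ₀) ≤ δD)
    (hDG : HasMajorant (g := toB6 (geo9K i) Rr Hp) (fun p : SiteY i × ι => ιB (blkOf i.D.toDomains p.1))
      (conj b (diffLetter (shiftY i) (UboxY i U) ((((etaS i : ℝ) : ℂ))⁻¹) (Sum.inl μ)) * conj b ((etaS i ^ 2) • (GpY i (parKnitY i) U).restrictScalars ℝ))
      (fun a a' => A₁ * (geo9K i).len a * Real.exp (-(δD * (geo9K i).dist a a'))))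
    (hrateG : (1 - α') * (ρ * δ₀) ≤ δG) (d₃ : ℕ) {ε₀ βx ρ₃ c₃ : ℝ} (hρ₃ : 0 ≤ ρ₃) (hβ : 0 ≤ βx) (hε₀ : 0 ≤ ε₀)
    (hr₃ : ρ₃ + 2 * (βx * ε₀) ≤ (1 - α') * (ρ * δ₀)) (h261₃ : Ineq261 d₃ (toB6 (geo9K i) Rr Hp) ε₀ βx)
    (hrow : ∀ a : (geo9K i).Site, ∑ a' : (geo9K i).Site, Real.exp (-(ρ₃ * (geo9K i).dist a a')) ≤ c₃)
    (Y : BlkY i → Matrix (Fin N) (Fin N) ℂ) {M : ℝ} (hY : ∀ s, ‖Y s‖ ≤ M) {j : ℕ} (hj : j ≤ n) (z : SiteY i) :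
    (((ℓ + 1 : ℕ) : ℝ)) ^ j *
        ‖cdS i U μ (GpY i (parKnitY i) U (GpY i (parKnitY i) U (QpsY i (parKnitY i) U (XinvY i (parKnitY i) (GpY i (parKnitY i)) U Y)))) z‖
      ≤ (∑ j, ‖b j‖) * (((M₂ * ∑ j, ‖b j‖) * A₁ * A
            * (Nn * B₀ * B6.c1 d' (ρ * δ₀) α' * (1 - (θ₁ + θ₂ + θ₃) * B6.c1 d' (ρ * δ₀) α')⁻¹) * B6.c1 d₃ ε₀ βx ^ 2) * c₃ * (M₂ * M)) := by
  have hCm := hasMajorant_conj_XinvY_parKnitY_of_site i b ιB hG hU hpar Oc hM₂ hrepr d' d₂ hA hCG hαGδ hα₂0 hα₂1 hδG hSTG h261G hGm hGc hrate Sχ S χ h Cl hs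
    hκD hℓ₀ hℓ₁ hB₀ hC0 hN hδ₀ hasep hρ hρb hαc hα'1 hsplit₁ hsplit₂ hsplit₃ hκG hθ₁ hθ₂ hθ₃ htri hrefl hsymm hdnn hST h261b h261 h263 hsmall hsq hh hS
    hcnt hχ01 hχS hsep hLip hloc hC hD
  have hK : 0 ≤ Nn * B₀ * B6.c1 d' (ρ * δ₀) α' * (1 - (θ₁ + θ₂ + θ₃) * B6.c1 d' (ρ * δ₀) α')⁻¹ :=
    mul_nonneg (mul_nonneg (mul_nonneg hN hB₀) (c1_nonneg _ _ _)) (inv_nonneg.2 (by linarith))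
  exact knit_E7_constLev i b ιB hlev hcf hG hpar hM₂ hrepr d₃ hA₁ hA hK hρ₃ hβ hε₀ hr₃ hs hdnn htri h261₃ μ
    (hasMajorant_len_rate_mono i _ _ hA₁ hdnn hrateD hDG) (hasMajorant_sq_rate_mono i _ _ hA hdnn hrateG hGm) hCm hrow Y hY hj z

/-- ★★★ **(E8) `hp_lap` OF `B8Thm2TorusLetters.LettersAt` AT THE KNIT LETTER FROM THEOREM-3.1-TYPE DATA, END TO END, IN THE CONSUMER's `covLap` ON THE
PERIODIC LIFT** (junction file 19's `knit_E8_at_box` ∘ file 20): as `knit_E6_constLev_of_site`, plus `c_f = L^k`; then for `η′ ≠ 0`, `j ≦ n`, `‖Y(s)‖ ≦ M`: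
`(Lʲη′)²‖(Δ^{η′}_{Ũ}(H′Y)~)(z)‖ ≦ (Σ‖b‖)·((M₂Σ‖b‖)AKc₁(ε₀,β))·c₃·(M₂M) + (Σ‖b‖)·((M₂Σ‖b‖)AAKc₁(ε₀,β)²)·c₃·(M₂M)` — [B8] (1.92) line 3 at print's transporters with NO
displayed (3.48) majorant left. [cite: Balaban1985RegularSpaces, (1.92) p.91, (1.17) p.78, p.77; Balaban1985BackgroundPropagators, (3.23)–(3.24) p.394, Thm 3.1 (3.42) p.397, Thm 3.2 (3.48) p.398, (3.49) p.399, Thm 3.9 p.413; Balaban1984PropagatorsII, (2.61) p.234] -/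
theorem knit_E8_at_box_of_site [Nonempty (Fin N)] {n : ℕ} (hlev : ∀ z : SiteY i, levY i z = n) (hcf : i.cf = (((ℓ + 1 : ℕ) : ℝ)) ^ i.k)
    (hG : G ≤ B7Prop2Explicit.unitaryUnits (Matrix (Fin N) (Fin N) ℂ))
    {U : CfgY (Matrix (Fin N) (Fin N) ℂ) i} (hU : ∀ μ x, U μ x ∈ G) (hpar : ∀ z w : SiteY i, parKnitY i U z w ∈ G)
    {κι : Type} [Fintype κι] (Oc : κι → SiteOpY (Matrix (Fin N) (Fin N) ℂ) i)
    {M₂ : ℝ} (hM₂ : 0 ≤ M₂) (hrepr : ∀ (v : Matrix (Fin N) (Fin N) ℂ) (j : ι), |b.repr v j| ≤ M₂ * ‖v‖) (d' d₂ : ℕ)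
    {A δG αG α₂ CG : ℝ} (hA : 0 ≤ A) (hCG : 0 ≤ CG) (hαGδ : 0 ≤ αG * δG) (hα₂0 : 0 ≤ α₂) (hα₂1 : α₂ ≤ 1) (hδG : 0 ≤ (1 - αG) * δG)
    (hSTG : B9Ineq347.ScaleTransfer (geo9K i) δG αG CG (fun a => (geo9K i).len a ^ 2))
    (h261G : Ineq261 d₂ (toB6 (geo9K i) Rr Hp) ((1 - αG) * δG) α₂)
    (hGm : HasMajorant (g := toB6 (geo9K i) Rr Hp) (fun p : SiteY i × ι => ιB (blkOf i.D.toDomains p.1))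
      (conj b ((etaS i ^ 2) • (GpY i (parKnitY i) U).restrictScalars ℝ)) (fun a a' => A * (geo9K i).len a ^ 2 * Real.exp (-(δG * (geo9K i).dist a a'))))
    (hGc : ∀ k, HasMajorant (g := toB6 (geo9K i) Rr Hp) (fun p : SiteY i × ι => ιB (blkOf i.D.toDomains p.1))
      (conj b ((etaS i ^ 2) • (Oc k U).restrictScalars ℝ)) (fun a a' => A * (geo9K i).len a ^ 2 * Real.exp (-(δG * (geo9K i).dist a a'))))
    {δ₀ aL aD αc αst asep ρ bb κG κD Dsep ℓ₀ ℓ₁ B₀ C Nn s α' θ₁ θ₂ θ₃ : ℝ} (hrate : aL * δ₀ ≤ (1 - α₂) * ((1 - αG) * δG))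
    (Sχ S : κι → Finset (geo9K i).Site) (χ h : κι → BlkY i → ℝ) (Cl : κι → Module.End ℝ (BlkY i → Matrix (Fin N) (Fin N) ℂ))
    (hs : (etaS i ^ 2 * etaS i ^ 2) * s = 1) (hκD : 0 ≤ κD) (hℓ₀ : 0 ≤ ℓ₀) (hℓ₁ : 0 ≤ ℓ₁) (hB₀ : 0 ≤ B₀) (hC0 : 0 ≤ C) (hN : 0 ≤ Nn)
    (hδ₀ : 0 ≤ δ₀) (hasep : 0 ≤ asep) (hρ : 0 ≤ ρ) (hρb : ρ ≤ bb) (hαc : 0 < αc * δ₀) (hα'1 : α' ≤ 1)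
    (hsplit₁ : αst + asep + ρ ≤ aL) (hsplit₂ : αst + ρ ≤ aD) (hsplit₃ : αst + αc + ρ ≤ aL)
    (hκG : κG = A ^ 2 * CG * B6.c1 d₂ ((1 - αG) * δG) α₂)
    (hθ₁ : θ₁ = Nn * (((M₂ * ∑ j, ‖b j‖) ^ 2 * κG) * B₀ * C * B6.c1 d' δ₀ (bb - ρ) * Real.exp (-(asep * δ₀ * Dsep))))
    (hθ₂ : θ₂ = Nn * (κD * Real.exp (-(2 * δ₀ * Dsep)) * B₀ * C * B6.c1 d' δ₀ (bb - ρ)))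
    (hθ₃ : θ₃ = Nn * ((ℓ₀ + ℓ₁ * (αc * δ₀)⁻¹) * ((M₂ * ∑ j, ‖b j‖) ^ 2 * κG) * B₀ * C * B6.c1 d' δ₀ (bb - ρ)))
    (htri : Triangle254 (toB6 (geo9K i) Rr Hp)) (hrefl : ∀ y : (geo9K i).Site, (geo9K i).dist y y = 0)
    (hsymm : ∀ a a' : (geo9K i).Site, (geo9K i).dist a a' = (geo9K i).dist a' a) (hdnn : ∀ a a' : (geo9K i).Site, 0 ≤ (geo9K i).dist a a')
    (hST : B9Ineq347.ScaleTransfer (geo9K i) δ₀ αst C (fun a => ((geo9K i).len a ^ 4)⁻¹)) (h261b : Ineq261 d' (toB6 (geo9K i) Rr Hp) δ₀ (bb - ρ))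
    (h261 : Ineq261 d' (toB6 (geo9K i) Rr Hp) (ρ * δ₀) α') (h263 : Ineq263 d' (toB6 (geo9K i) Rr Hp) (ρ * δ₀) α')
    (hsmall : (θ₁ + θ₂ + θ₃) * B6.c1 d' (ρ * δ₀) α' < 1)
    (hsq : ∀ t, ∑ k, h k t ^ 2 = 1) (hh : ∀ k t, |h k t| ≤ 1) (hS : ∀ k t, h k t ≠ 0 → ιB t ∈ S k)
    (hcnt : ∀ a : (geo9K i).Site, (∑ k, if a ∈ S k then (1 : ℝ) else 0) ≤ Nn)
    (hχ01 : ∀ k t, 0 ≤ χ k t ∧ χ k t ≤ 1) (hχS : ∀ k t, ιB t ∈ Sχ k → χ k t = 1)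
    (hsep : ∀ k a, a ∉ Sχ k → ∀ a'' ∈ S k, Dsep ≤ (geo9K i).dist a a'')
    (hLip : ∀ k (t t' : BlkY i), |h k t' - h k t| ≤ ℓ₀ + ℓ₁ * (geo9K i).dist (ιB t) (ιB t'))
    (hloc : ∀ k, (cutMulY (𝔸 := Matrix (Fin N) (Fin N) ℂ) (h k)).restrictScalars ℝ *
      ((cutMulY (𝔸 := Matrix (Fin N) (Fin N) ℂ) (χ k)).restrictScalars ℝ * (XY i (parKnitY i) (Oc k) U).restrictScalars ℝ) * Cl k *
        (cutMulY (𝔸 := Matrix (Fin N) (Fin N) ℂ) (h k)).restrictScalars ℝ =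
      (cutMulY (𝔸 := Matrix (Fin N) (Fin N) ℂ) (h k)).restrictScalars ℝ * (cutMulY (𝔸 := Matrix (Fin N) (Fin N) ℂ) (h k)).restrictScalars ℝ)
    (hC : ∀ k, HasMajorant (g := toB6 (geo9K i) Rr Hp) (fun p : BlkY i × ι => ιB p.1) (conj b (s • Cl k))
      (fun a a' => if a ∈ S k then B₀ * ((geo9K i).len a ^ 4)⁻¹ * Real.exp (-(bb * δ₀ * (geo9K i).dist a a')) else 0))
    (hD : ∀ k, HasMajorant (g := toB6 (geo9K i) Rr Hp) (fun p : BlkY i × ι => ιB p.1)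
      (conj b ((etaS i ^ 2 * etaS i ^ 2) • ((XY i (parKnitY i) (GpY i (parKnitY i)) U).restrictScalars ℝ - (XY i (parKnitY i) (Oc k) U).restrictScalars ℝ)))
      (fun a a'' => κD * Real.exp (-(2 * δ₀ * Dsep)) * (geo9K i).len a ^ 4 * Real.exp (-(aD * δ₀ * (geo9K i).dist a a''))))
    -- the word of (3.49): rates, (2.61) at `(ε₀, β)`, row sum at `ρ₃`
    (hrateG : (1 - α') * (ρ * δ₀) ≤ δG) (d₃ : ℕ) {ε₀ βx ρ₃ c₃ : ℝ} (hρ₃ : 0 ≤ ρ₃) (hβ : 0 ≤ βx) (hε₀ : 0 ≤ ε₀)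
    (hr₃ : ρ₃ + 2 * (βx * ε₀) ≤ (1 - α') * (ρ * δ₀)) (h261₃ : Ineq261 d₃ (toB6 (geo9K i) Rr Hp) ε₀ βx)
    (hrow : ∀ a : (geo9K i).Site, ∑ a' : (geo9K i).Site, Real.exp (-(ρ₃ * (geo9K i).dist a a')) ≤ c₃)
    (Y : BlkY i → Matrix (Fin N) (Fin N) ℂ) {M : ℝ} (hY : ∀ s, ‖Y s‖ ≤ M) {η' : ℝ} (hη' : η' ≠ 0) {j : ℕ} (hj : j ≤ n) (z : SiteY i) :
    ((((ℓ + 1 : ℕ) : ℝ)) ^ j * η') ^ 2 *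
        ‖covLap η' (liftCfg U)
            (liftFun ((GpY i (parKnitY i) U (GpY i (parKnitY i) U (QpsY i (parKnitY i) U (XinvY i (parKnitY i) (GpY i (parKnitY i)) U Y))))
              ∘ ⇑(boxEquiv i.hN))) z.1‖
      ≤ (∑ j, ‖b j‖) * (((M₂ * ∑ j, ‖b j‖) * A
            * (Nn * B₀ * B6.c1 d' (ρ * δ₀) α' * (1 - (θ₁ + θ₂ + θ₃) * B6.c1 d' (ρ * δ₀) α')⁻¹) * B6.c1 d₃ ε₀ βx) * c₃ * (M₂ * M))
        + (∑ j, ‖b j‖) * (((M₂ * ∑ j, ‖b j‖) * A * A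
            * (Nn * B₀ * B6.c1 d' (ρ * δ₀) α' * (1 - (θ₁ + θ₂ + θ₃) * B6.c1 d' (ρ * δ₀) α')⁻¹) * B6.c1 d₃ ε₀ βx ^ 2) * c₃ * (M₂ * M)) := by
  have hCm := hasMajorant_conj_XinvY_parKnitY_of_site i b ιB hG hU hpar Oc hM₂ hrepr d' d₂ hA hCG hαGδ hα₂0 hα₂1 hδG hSTG h261G hGm hGc hrate Sχ S χ h Cl hs
    hκD hℓ₀ hℓ₁ hB₀ hC0 hN hδ₀ hasep hρ hρb hαc hα'1 hsplit₁ hsplit₂ hsplit₃ hκG hθ₁ hθ₂ hθ₃ htri hrefl hsymm hdnn hST h261b h261 h263 hsmall hsq hh hS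
    hcnt hχ01 hχS hsep hLip hloc hC hD
  have hK : 0 ≤ Nn * B₀ * B6.c1 d' (ρ * δ₀) α' * (1 - (θ₁ + θ₂ + θ₃) * B6.c1 d' (ρ * δ₀) α')⁻¹ :=
    mul_nonneg (mul_nonneg (mul_nonneg hN hB₀) (c1_nonneg _ _ _)) (inv_nonneg.2 (by linarith))
  exact knit_E8_at_box i b ιB hlev hcf hG hU hpar hM₂ hrepr d₃ hA hK hρ₃ hβ hε₀ hr₃ hs hdnn htri h261₃
    (hasMajorant_sq_rate_mono i _ _ hA hdnn hrateG hGm) hCm hrow Y hY hη' hj z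

/-! ## (E7), (E8) in the consumer's operators on the periodic lift, at EVERY point of `ℤ^{d+1}` (J-A dictionary `covDerivFwd_liftY`, `covLap_liftY`) -/

omit [DecidableEq ι] in
/-- ★★ **(E7) IN THE CONSUMER's `covDerivFwd` ON THE PERIODIC LIFT, AT EVERY POINT OF `ℤ^{d+1}`** (junction file 18's `knit_E7_constLev'` read through J-A's
`covDerivFwd_liftY`: `D^{η′}_{Ũ,μ}(Φ∘chart)~(x) = η′⁻¹·(∇_{U,μ}Φ)(chart(x mod box))`): under the hypotheses of `knit_E7_constLev'` (displayed `hDG`, `hGm`, `hC`), for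
`0 < η′`, `j ≦ n`, `‖Y(s)‖ ≦ M` and every `x`:
`(Lʲη′)·‖(D^{η′}_{Ũ,μ}(H′Y)~)(x)‖ ≦ (Σ‖b_j‖)·((M₂Σ‖b_j‖)·A₁·A·K·c₁²)·c·(M₂M)` — the shape of `KnitEstimates.hp_grad`'s left side (`wt L η j = Lʲη`).
[cite: Balaban1985RegularSpaces, (1.92) p.91, (1.1) p.76, (1.17) p.78; Balaban1985BackgroundPropagators, (3.3) p.390, Thm 3.1 (3.42) p.397, Thm 3.2 (3.48) p.398, (3.49) p.399] -/
theorem knit_E7_lift [Nonempty (Fin N)] {n : ℕ} (hlev : ∀ z : SiteY i, levY i z = n) (hcf : i.cf = (((ℓ + 1 : ℕ) : ℝ)) ^ i.k)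
    (hG : G ≤ B7Prop2Explicit.unitaryUnits (Matrix (Fin N) (Fin N) ℂ))
    {U : CfgY (Matrix (Fin N) (Fin N) ℂ) i} (hpar : ∀ z w : SiteY i, parKnitY i U z w ∈ G)
    {M₂ : ℝ} (hM₂ : 0 ≤ M₂) (hrepr : ∀ (v : Matrix (Fin N) (Fin N) ℂ) (j : ι), |b.repr v j| ≤ M₂ * ‖v‖)
    (d₁ : ℕ) {δ₀ δ βx ρ A₁ A K s c : ℝ} (hA₁ : 0 ≤ A₁) (hA : 0 ≤ A) (hK : 0 ≤ K) (hρ : 0 ≤ ρ) (hβ : 0 ≤ βx) (hδ₀ : 0 ≤ δ₀)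
    (hr : ρ + 2 * (βx * δ₀) ≤ δ) (hs : (etaS i ^ 2 * etaS i ^ 2) * s = 1)
    (hdnn : ∀ a a' : (geo9K i).Site, 0 ≤ (geo9K i).dist a a') (htri : Triangle254 (toB6 (geo9K i) Rr Hp))
    (h261 : Ineq261 d₁ (toB6 (geo9K i) Rr Hp) δ₀ βx) (μ : Fin (d + 1))
    (hDG : HasMajorant (g := toB6 (geo9K i) Rr Hp) (fun p : SiteY i × ι => ιB (blkOf i.D.toDomains p.1))
      (conj b (diffLetter (shiftY i) (UboxY i U) ((((etaS i : ℝ) : ℂ))⁻¹) (Sum.inl μ)) * conj b ((etaS i ^ 2) • (GpY i (parKnitY i) U).restrictScalars ℝ))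
      (fun a a' => A₁ * (geo9K i).len a * Real.exp (-(δ * (geo9K i).dist a a'))))
    (hGm : HasMajorant (g := toB6 (geo9K i) Rr Hp) (fun p : SiteY i × ι => ιB (blkOf i.D.toDomains p.1))
      (conj b ((etaS i ^ 2) • (GpY i (parKnitY i) U).restrictScalars ℝ)) (fun a a' => A * (geo9K i).len a ^ 2 * Real.exp (-(δ * (geo9K i).dist a a'))))
    (hC : HasMajorant (g := toB6 (geo9K i) Rr Hp) (fun q : BlkY i × ι => ιB q.1)
      (conj b (s • (XinvY i (parKnitY i) (GpY i (parKnitY i)) U).restrictScalars ℝ))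
      (fun a a' => K * ((geo9K i).len a ^ 4)⁻¹ * Real.exp (-(δ * (geo9K i).dist a a'))))
    (hrow : ∀ a : (geo9K i).Site, ∑ a' : (geo9K i).Site, Real.exp (-(ρ * (geo9K i).dist a a')) ≤ c)
    {η' : ℝ} (hη' : 0 < η') (Y : BlkY i → Matrix (Fin N) (Fin N) ℂ) {M : ℝ} (hY : ∀ s, ‖Y s‖ ≤ M) {j : ℕ} (hj : j ≤ n) (x : B7Prop1Explicit.Site (d + 1)) :
    ((((ℓ + 1 : ℕ) : ℝ)) ^ j * η') *
        ‖covDerivFwd η' (liftCfg U) μ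
            (liftFun ((GpY i (parKnitY i) U (GpY i (parKnitY i) U (QpsY i (parKnitY i) U (XinvY i (parKnitY i) (GpY i (parKnitY i)) U Y))))
              ∘ ⇑(boxEquiv i.hN))) x‖
      ≤ (∑ j, ‖b j‖) * (((M₂ * ∑ j, ‖b j‖) * A₁ * A * K * B6.c1 d₁ δ₀ βx ^ 2) * c * (M₂ * M)) := by
  have h := knit_E7_constLev' i b ιB hlev hcf hG hpar hM₂ hrepr d₁ hA₁ hA hK hρ hβ hδ₀ hr hs hdnn htri h261 μ hDG hGm hC hrow hη' Y hY hj
    (boxEquiv i.hN (transl 0 x))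
  rw [covDerivFwd_liftY, norm_smul, Real.norm_of_nonneg (inv_nonneg.2 hη'.le)]
  exact h

omit [DecidableEq ι] in
/-- ★★ **(E8) IN THE CONSUMER's `covLap` ON THE PERIODIC LIFT, AT EVERY POINT OF `ℤ^{d+1}`** (junction file 19's `knit_E8_constLev` read through J-A's `covLap_liftY`;
file 19's `knit_E8_at_box` is the case of a box point): under the hypotheses of `knit_E8_constLev`, for `η′ ≠ 0`, `j ≦ n`, `‖Y(s)‖ ≦ M` and every `x`:
`(Lʲη′)²‖(Δ^{η′}_{Ũ}(H′Y)~)(x)‖ ≦ (Σ‖b‖)·((M₂Σ‖b‖)AKc₁)·c·(M₂M) + (Σ‖b‖)·((M₂Σ‖b‖)AAKc₁²)·c·(M₂M)` — the shape of `KnitEstimates.hp_lap`'s `Bd2` line.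
[cite: Balaban1985RegularSpaces, (1.92) p.91, (1.1) p.76, (1.17) p.78; Balaban1985BackgroundPropagators, (3.23)–(3.24) p.394, Thm 3.1 (3.42) p.397, Thm 3.2 (3.48) p.398, (3.49) p.399] -/
theorem knit_E8_lift [Nonempty (Fin N)] {n : ℕ} (hlev : ∀ z : SiteY i, levY i z = n) (hcf : i.cf = (((ℓ + 1 : ℕ) : ℝ)) ^ i.k)
    (hG : G ≤ B7Prop2Explicit.unitaryUnits (Matrix (Fin N) (Fin N) ℂ))
    {U : CfgY (Matrix (Fin N) (Fin N) ℂ) i} (hU : ∀ μ x, U μ x ∈ G) (hpar : ∀ z w : SiteY i, parKnitY i U z w ∈ G)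
    {M₂ : ℝ} (hM₂ : 0 ≤ M₂) (hrepr : ∀ (v : Matrix (Fin N) (Fin N) ℂ) (j : ι), |b.repr v j| ≤ M₂ * ‖v‖)
    (d₁ : ℕ) {δ₀ δ βx ρ A K s c : ℝ} (hA : 0 ≤ A) (hK : 0 ≤ K) (hρ : 0 ≤ ρ) (hβ : 0 ≤ βx) (hδ₀ : 0 ≤ δ₀) (hr : ρ + 2 * (βx * δ₀) ≤ δ)
    (hs : (etaS i ^ 2 * etaS i ^ 2) * s = 1)
    (hdnn : ∀ a a' : (geo9K i).Site, 0 ≤ (geo9K i).dist a a') (htri : Triangle254 (toB6 (geo9K i) Rr Hp))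
    (h261 : Ineq261 d₁ (toB6 (geo9K i) Rr Hp) δ₀ βx)
    (hGm : HasMajorant (g := toB6 (geo9K i) Rr Hp) (fun p : SiteY i × ι => ιB (blkOf i.D.toDomains p.1))
      (conj b ((etaS i ^ 2) • (GpY i (parKnitY i) U).restrictScalars ℝ)) (fun a a' => A * (geo9K i).len a ^ 2 * Real.exp (-(δ * (geo9K i).dist a a'))))
    (hC : HasMajorant (g := toB6 (geo9K i) Rr Hp) (fun q : BlkY i × ι => ιB q.1)
      (conj b (s • (XinvY i (parKnitY i) (GpY i (parKnitY i)) U).restrictScalars ℝ))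
      (fun a a' => K * ((geo9K i).len a ^ 4)⁻¹ * Real.exp (-(δ * (geo9K i).dist a a'))))
    (hrow : ∀ a : (geo9K i).Site, ∑ a' : (geo9K i).Site, Real.exp (-(ρ * (geo9K i).dist a a')) ≤ c)
    (Y : BlkY i → Matrix (Fin N) (Fin N) ℂ) {M : ℝ} (hY : ∀ s, ‖Y s‖ ≤ M) {η' : ℝ} (hη' : η' ≠ 0) {j : ℕ} (hj : j ≤ n) (x : B7Prop1Explicit.Site (d + 1)) :
    ((((ℓ + 1 : ℕ) : ℝ)) ^ j * η') ^ 2 *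
        ‖covLap η' (liftCfg U)
            (liftFun ((GpY i (parKnitY i) U (GpY i (parKnitY i) U (QpsY i (parKnitY i) U (XinvY i (parKnitY i) (GpY i (parKnitY i)) U Y))))
              ∘ ⇑(boxEquiv i.hN))) x‖
      ≤ (∑ j, ‖b j‖) * (((M₂ * ∑ j, ‖b j‖) * A * K * B6.c1 d₁ δ₀ βx) * c * (M₂ * M))
        + (∑ j, ‖b j‖) * (((M₂ * ∑ j, ‖b j‖) * A * A * K * B6.c1 d₁ δ₀ βx ^ 2) * c * (M₂ * M)) := by
  have h := knit_E8_constLev i b ιB hlev hcf hG hU hpar hM₂ hrepr d₁ hA hK hρ hβ hδ₀ hr hs hdnn htri h261 hGm hC hrow Y hY hj (boxEquiv i.hN (transl 0 x))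
  rw [covLap_liftY, norm_smul, Real.norm_of_nonneg (mul_self_nonneg η'⁻¹)]
  have e : ((((ℓ + 1 : ℕ) : ℝ)) ^ j * η') ^ 2 * (η'⁻¹ * η'⁻¹ *
      ‖lapS i U (GpY i (parKnitY i) U (GpY i (parKnitY i) U (QpsY i (parKnitY i) U (XinvY i (parKnitY i) (GpY i (parKnitY i)) U Y))))
        (boxEquiv i.hN (transl 0 x))‖)
      = ((((ℓ + 1 : ℕ) : ℝ)) ^ j) ^ 2 *
        ‖lapS i U (GpY i (parKnitY i) U (GpY i (parKnitY i) U (QpsY i (parKnitY i) U (XinvY i (parKnitY i) (GpY i (parKnitY i)) U Y))))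
          (boxEquiv i.hN (transl 0 x))‖ := by
    field_simp
  rw [e]
  exact h

end Knit

end Literature.MathematicalPhysics.QuantumFieldTheory.Balaban1983to89.B9B8KnitLetterHprimeFromM56

end
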